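import Summits.BirchSwinnertonDyer.BirchSwinnertonDyer.Theses.QuadraticBranchSignedControl
import Summits.BirchSwinnertonDyer.Rank1Residual.Additive.QuadraticBranchPlusEtaNodes
import Summits.BirchSwinnertonDyer.BirchSwinnertonDyer.Theorems.QuadraticBranchSignedControlPlusMainConjectureBranchSeams
import HarnessLib

/-!
# Route `QuadraticBranchSignedControl` (rung K8, cell `bsd-potss`): glue item
# stmt-BirchSwinnertonDyer-19609 `PlusMainConjectureNonsurjBranchOfEta` — CLOSED

WHAT. The planner's glued split (plan g13, TARGET R102a, route rev 19) of the declared residual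
`PlusMainConjectureNonsurjBranch` (item 19243: Kobayashi's even main conjecture (C1_η) in the cell's
`F`-form `QuadraticBranchPlusMainConjectureAt V p` on the Gss2 twists `V` whose `p`-adic tower is NOT
onto) into

* the crux child `PlusEtaMainConjectureNonsurj` (item 19606): the SAME conjecture in PRINT currency —
  Kobayashi's even main conjecture on the `η`-component `X⁺(V/K_∞)^η` VERBATIM (node
  `Additive.QuadraticBranchPlusEtaMainConjectureAt V p`) on the non-onto rows;
* the support child `EtaDescentFrameNonsurj` (item 19607): the ∀-form prime-to-`p` descent frame
  `Sel⁺(V'/F_∞) ≃ Sel⁺(V/ℚ_∞) × Sel⁺(V/K₀ℚ_∞)^η` (Γ-equivariant, every admissible quadratic model),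
  restricted to the non-onto rows;
* the held alias `PublishedInputKobThm12Nonsurj` (item 19608) of the NAMED Literature fact
  Kobayashi 2003 Thm. 1.2 (`X^±(E/ℚ_∞)` finitely generated `Λ`-torsion);

has the glue statement `PlusEtaMainConjectureNonsurj → EtaDescentFrameNonsurj →
PublishedInputKobThm12Nonsurj → PlusMainConjectureNonsurjBranch`. This file proves it — the
planner-CERTIFIED term (HOME `plan/edit-g13/K8eta/K8EtaSketch.lean`, rc 0): seat k8q-c2 g0's per-pair
currency seam `quadraticBranchPlusMainConjectureAt_of_etaPlusMainConjecture_of_decomposition`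
(p416834/`…PlusMainConjectureBranchSeams.lean`: (C1⁺_η) on the `η`-object + the frame + Thm. 1.2 ⟹
(C1_η) in `F`-form, by the product dual datum on `D.X × Dη.X`, uniqueness of signed dual data and
multiplicativity of `Char`) instantiated at `K₀ = ℚ(ζ_p)` (`CyclotomicField p ℚ`, whose `galRange` is
normal — `normal_galRange_cyclotomic`) with the even non-trivial sign character `ηq` of `√p* ∈ ℚ(ζ_p)`
(`exists_theta_eta_cyclotomicField`), the non-onto row condition threaded through both children.

HONEST FRAMING (cell `bsd-potss`, run/shared/lean/pub/bsd-potss/; FULL-BSD rank ≤ 1 programme): PURE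
GLUE — closes the glue leaf 19609 of rung K8 only («closes a glue leaf of rung K8 of
BirchSwinnertonDyer, never summit credit»). The crux child 19606 (open problem class-wide: for CM `V`
Pollack–Rubin's remark p. 448, nothing in print on the non-CM normaliser-of-non-split-Cartan rows) and
the frame child 19607 are NOT proved here; nothing is booked; `BSD(W, p)` is claimed for no pair.
Seat `bsd-potss-k8eta-c2` (prover), g0; `--workitem stmt-BirchSwinnertonDyer-19609`.

References: [Kobayashi2003] Thm. 1.2 (p. 2), §4 Even main conjecture + Thm. 4.1 (p. 8);
[PollackRubin2004] p. 448 (CM remark); [GreenbergLNM1716] §3 (prime-to-p descent).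
-/

set_option autoImplicit false
set_option linter.dupNamespace false

noncomputable section

open scoped Classical

open CongruenceSubgroup Field WeierstrassCurve
open Literature.NumberTheory.EllipticCurves
open Literature.NumberTheory.EllipticCurves.ModularForms
open Literature.NumberTheory.GaloisRepresentations
open Summit.BirchSwinnertonDyer.Rank1Residual.Additive
open Summit.BirchSwinnertonDyer.Rank1Residual.Additive.SignedTwist
open Summit.BirchSwinnertonDyer.BirchSwinnertonDyer.Theses.QuadraticBranchSignedControl

namespace Summit.BirchSwinnertonDyer.BirchSwinnertonDyer.Theorems

/-- **Glue 19243 (item stmt-BirchSwinnertonDyer-19609) `PlusMainConjectureNonsurjBranchOfEta`.**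
`PlusEtaMainConjectureNonsurj → EtaDescentFrameNonsurj → PublishedInputKobThm12Nonsurj →
PlusMainConjectureNonsurjBranch`: on every Gss2 twist `V` (`p ≥ 5`, good, `a_p = 0`) whose `p`-adic
tower is not onto, Kobayashi's even main conjecture on the `η`-component `X⁺(V/K_∞)^η` (print
currency, node `QuadraticBranchPlusEtaMainConjectureAt V p`), the ∀-form prime-to-`p` descent frame on
those rows and Kobayashi's Thm. 1.2 give the cell's `F`-form (C1_η)
`QuadraticBranchPlusMainConjectureAt V p` — seat k8q-c2's per-pair currency seam
`quadraticBranchPlusMainConjectureAt_of_etaPlusMainConjecture_of_decomposition` at `K₀ = ℚ(ζ_p)`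
with the sign character of `√p*` (`exists_theta_eta_cyclotomicField`). Pure glue (planner-certified
term, plan g13 R102a); the children are hypotheses, nothing is asserted about any curve.
[cite: Kobayashi2003, Thm. 1.2 (p. 2) and §4 Even main conjecture (p. 8)] -/
theorem plusMainConjectureNonsurjBranchOfEta_proof : PlusMainConjectureNonsurjBranchOfEta := by
  intro hC hdec h12 V _ _ p _ hp5 hgood hap hns
  have hp2 : p ≠ 2 := by omega
  haveI : NeZero p := ⟨(Fact.out : p.Prime).ne_zero⟩
  haveI : IsCyclotomicExtension {p} ℚ (CyclotomicField p ℚ) :=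
    CyclotomicField.isCyclotomicExtension p ℚ
  haveI : (galRange (K := ℚ) (CyclotomicField p ℚ)).Normal := normal_galRange_cyclotomic p _
  obtain ⟨θ, ηq, -, -, -, hηK, hη1⟩ := exists_theta_eta_cyclotomicField p hp2
  exact quadraticBranchPlusMainConjectureAt_of_etaPlusMainConjecture_of_decomposition h12
    (CyclotomicField p ℚ) ηq
    (fun κ γ hκ hγ hγK hγc F _ _ V' _ κF γF hF hθ hC' hκF hγF hζ =>
      hdec p hp5 (CyclotomicField p ℚ) ηq hηK hη1 V hgood hap hns κ γ hκ hγ hγK hγc F V' κF γF hF hθ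
        hC' hκF hγF hζ)
    (fun hp2' hgood' hap' hf ϖ hϖ Lη hL κ γ hκ hγ hγK hγc D =>
      hC V p hp5 hgood hap hns (CyclotomicField p ℚ) ηq hηK hη1 hp2' hgood' hap' hf ϖ hϖ Lη hL κ γ
        hκ hγ hγK hγc D)

end Summit.BirchSwinnertonDyer.BirchSwinnertonDyer.Theorems

end
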